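import Summits.Ventures.PercRepro.RLSGenericT1Sums

/-!
# C-025 at q = 3: the class-witness sums of the dependent-witness case (iv) at t = 1 (night-3)

A 3-class of N-parallel points along a 3-point line `ℓ₃` of `G` (type `t = 1`, outside points `p − 1 = n + 3`) merges with every
subset `B' ⊇ ℓ₃` into a 6-point trace; the 𝒯₀ subsets `B' ⊇ ℓ₃` (4 or 5 points) lose their whole share on the witnesses containing the
class (`C(p−4, x−3)` at level `x`), the 6-point ones at most theirs.  Hence the sums `cwSum n = Σ_{x≥3} C(p−4, x−3) = 2^n − C(n,2) − n − 1`,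
`ct4Sum n = Σ_{x≥3} C(p−4,x−3)/C(x+4,3)`, `ct5Sum n = Σ_{x≥3} C(p−4,x−3)/C(x+5,3)` (`x = i + 3`, `i < n − 2`), in closed form via Pascal
`C(n,i) = C(n+1,i+1) − C(n,i+1)` and the partial fractions `1/C(i+7,3) = 1/C(i+4,3) − (9/4)/C(i+5,4) + (9/5)/C(i+6,5) − (1/2)/C(i+7,6)`,
`1/C(i+8,3) = 1/C(i+4,3) − 3/C(i+5,4) + (18/5)/C(i+6,5) − 2/C(i+7,6) + (3/7)/C(i+8,7)`.  No `decide`.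
-/

open PercRepro.NightThree.CF PercRepro.NightThree.U1

namespace PercRepro.NightThree.U1

open Finset

/-- `Σ_{y<7} C(N,y)` spelled out. -/
theorem sum_range_seven (N : ℕ) : (∑ y ∈ range 7, (N.choose y : ℚ)) =
    1 + N + (N.choose 2 : ℚ) + (N.choose 3 : ℚ) + (N.choose 4 : ℚ) + (N.choose 5 : ℚ) + (N.choose 6 : ℚ) := by
  simp [sum_range_succ]

/-- `Σ_{y<8} C(N,y)` spelled out. -/
theorem sum_range_eight (N : ℕ) : (∑ y ∈ range 8, (N.choose y : ℚ)) =
    1 + N + (N.choose 2 : ℚ) + (N.choose 3 : ℚ) + (N.choose 4 : ℚ) + (N.choose 5 : ℚ) + (N.choose 6 : ℚ) + (N.choose 7 : ℚ) := by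
  simp [sum_range_succ]

/-- `C(N,6)` in `ℚ`. -/
theorem choose_six_cast (N : ℕ) :
    (N.choose 6 : ℚ) = (N : ℚ) * ((N : ℚ) - 1) * ((N : ℚ) - 2) * ((N : ℚ) - 3) * ((N : ℚ) - 4) * ((N : ℚ) - 5) / 720 := by
  induction N with
  | zero => simp
  | succ m ih =>
    rw [Nat.choose_succ_succ']
    push_cast
    rw [ih, choose_five_cast]; ring

/-- `C(N,7)` in `ℚ`. -/
theorem choose_seven_cast (N : ℕ) :
    (N.choose 7 : ℚ) = (N : ℚ) * ((N : ℚ) - 1) * ((N : ℚ) - 2) * ((N : ℚ) - 3) * ((N : ℚ) - 4) * ((N : ℚ) - 5) * ((N : ℚ) - 6) / 5040 := by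
  induction N with
  | zero => simp
  | succ m ih =>
    rw [Nat.choose_succ_succ']
    push_cast
    rw [ih, choose_six_cast]; ring

/-- `1/C(i+7,3)` as a combination of `1/C(i+4+j, 3+j)`. -/
theorem inv_choose_7 (i : ℕ) : (1 : ℚ) / ((i + 7).choose 3 : ℚ) = (1 : ℚ) * (1 / ((i + 4).choose 3 : ℚ)) + (-(9/4) : ℚ) * (1 / ((i + 5).choose 4 : ℚ)) + (9/5 : ℚ) * (1 / ((i + 6).choose 5 : ℚ)) + (-(1/2) : ℚ) * (1 / ((i + 7).choose 6 : ℚ)) := by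
  have e0 : ((i + 4).choose 3 : ℚ) = ((i : ℚ) + 4) * ((i : ℚ) + 3) * ((i : ℚ) + 2) / 6 := by
    rw [choose_three_cast]; push_cast; ring
  have e1 : ((i + 5).choose 4 : ℚ) = ((i : ℚ) + 5) * ((i : ℚ) + 4) * ((i : ℚ) + 3) * ((i : ℚ) + 2) / 24 := by
    rw [choose_four_cast]; push_cast; ring
  have e2 : ((i + 6).choose 5 : ℚ) = ((i : ℚ) + 6) * ((i : ℚ) + 5) * ((i : ℚ) + 4) * ((i : ℚ) + 3) * ((i : ℚ) + 2) / 120 := by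
    rw [choose_five_cast]; push_cast; ring
  have e3 : ((i + 7).choose 6 : ℚ) = ((i : ℚ) + 7) * ((i : ℚ) + 6) * ((i : ℚ) + 5) * ((i : ℚ) + 4) * ((i : ℚ) + 3) * ((i : ℚ) + 2) / 720 := by
    rw [choose_six_cast]; push_cast; ring
  have et : ((i + 7).choose 3 : ℚ) = ((i : ℚ) + 7) * ((i : ℚ) + 6) * ((i : ℚ) + 5) / 6 := by
    rw [choose_three_cast]; push_cast; ring
  rw [et, e0, e1, e2, e3]
  have h1 : ((i : ℚ) + 1) ≠ 0 := by positivity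
  have h2 : ((i : ℚ) + 2) ≠ 0 := by positivity
  have h3 : ((i : ℚ) + 3) ≠ 0 := by positivity
  have h4 : ((i : ℚ) + 4) ≠ 0 := by positivity
  have h5 : ((i : ℚ) + 5) ≠ 0 := by positivity
  have h6 : ((i : ℚ) + 6) ≠ 0 := by positivity
  have h7 : ((i : ℚ) + 7) ≠ 0 := by positivity
  field_simp
  ring

/-- `1/C(i+8,3)` as a combination of `1/C(i+4+j, 3+j)`. -/
theorem inv_choose_8 (i : ℕ) : (1 : ℚ) / ((i + 8).choose 3 : ℚ) = (1 : ℚ) * (1 / ((i + 4).choose 3 : ℚ)) + (-3 : ℚ) * (1 / ((i + 5).choose 4 : ℚ)) + (18/5 : ℚ) * (1 / ((i + 6).choose 5 : ℚ)) + (-2 : ℚ) * (1 / ((i + 7).choose 6 : ℚ)) + (3/7 : ℚ) * (1 / ((i + 8).choose 7 : ℚ)) := by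
  have e0 : ((i + 4).choose 3 : ℚ) = ((i : ℚ) + 4) * ((i : ℚ) + 3) * ((i : ℚ) + 2) / 6 := by
    rw [choose_three_cast]; push_cast; ring
  have e1 : ((i + 5).choose 4 : ℚ) = ((i : ℚ) + 5) * ((i : ℚ) + 4) * ((i : ℚ) + 3) * ((i : ℚ) + 2) / 24 := by
    rw [choose_four_cast]; push_cast; ring
  have e2 : ((i + 6).choose 5 : ℚ) = ((i : ℚ) + 6) * ((i : ℚ) + 5) * ((i : ℚ) + 4) * ((i : ℚ) + 3) * ((i : ℚ) + 2) / 120 := by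
    rw [choose_five_cast]; push_cast; ring
  have e3 : ((i + 7).choose 6 : ℚ) = ((i : ℚ) + 7) * ((i : ℚ) + 6) * ((i : ℚ) + 5) * ((i : ℚ) + 4) * ((i : ℚ) + 3) * ((i : ℚ) + 2) / 720 := by
    rw [choose_six_cast]; push_cast; ring
  have e4 : ((i + 8).choose 7 : ℚ) = ((i : ℚ) + 8) * ((i : ℚ) + 7) * ((i : ℚ) + 6) * ((i : ℚ) + 5) * ((i : ℚ) + 4) * ((i : ℚ) + 3) * ((i : ℚ) + 2) / 5040 := by
    rw [choose_seven_cast]; push_cast; ring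
  have et : ((i + 8).choose 3 : ℚ) = ((i : ℚ) + 8) * ((i : ℚ) + 7) * ((i : ℚ) + 6) / 6 := by
    rw [choose_three_cast]; push_cast; ring
  rw [et, e0, e1, e2, e3, e4]
  have h1 : ((i : ℚ) + 1) ≠ 0 := by positivity
  have h2 : ((i : ℚ) + 2) ≠ 0 := by positivity
  have h3 : ((i : ℚ) + 3) ≠ 0 := by positivity
  have h4 : ((i : ℚ) + 4) ≠ 0 := by positivity
  have h5 : ((i : ℚ) + 5) ≠ 0 := by positivity
  have h6 : ((i : ℚ) + 6) ≠ 0 := by positivity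
  have h7 : ((i : ℚ) + 7) ≠ 0 := by positivity
  have h8 : ((i : ℚ) + 8) ≠ 0 := by positivity
  field_simp
  ring

/-- `C(m,i+1)/C(i+4,3) = C(m+3, i+4)/C(m+3,3)`. -/
theorem ratio_0 (m i : ℕ) : (m.choose (i + 1) : ℚ) / ((i + 4).choose 3 : ℚ) = ((m + 3).choose (i + 4) : ℚ) / ((m + 3).choose 3 : ℚ) := by
  have hP : (((i + 4).choose 3 : ℕ) : ℚ) ≠ 0 := by exact_mod_cast (Nat.choose_pos (by omega)).ne'
  have hV : (((m + 3).choose 3 : ℕ) : ℚ) ≠ 0 := by exact_mod_cast (Nat.choose_pos (by omega)).ne'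
  rw [div_eq_div_iff hP hV]
  have h := Nat.choose_mul (n := m + 3) (k := i + 4) (s := 3) (by omega)
  rw [show m + 3 - 3 = m by omega, show i + 4 - 3 = i + 1 by omega] at h
  have h' : ((m + 3).choose (i + 4) : ℚ) * ((i + 4).choose 3 : ℚ) = ((m + 3).choose 3 : ℚ) * (m.choose (i + 1) : ℚ) := by
    exact_mod_cast h
  linear_combination -h'

/-- `C(m,i+1)/C(i+5,4) = C(m+4, i+5)/C(m+4,4)`. -/
theorem ratio_1 (m i : ℕ) : (m.choose (i + 1) : ℚ) / ((i + 5).choose 4 : ℚ) = ((m + 4).choose (i + 5) : ℚ) / ((m + 4).choose 4 : ℚ) := by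
  have hP : (((i + 5).choose 4 : ℕ) : ℚ) ≠ 0 := by exact_mod_cast (Nat.choose_pos (by omega)).ne'
  have hV : (((m + 4).choose 4 : ℕ) : ℚ) ≠ 0 := by exact_mod_cast (Nat.choose_pos (by omega)).ne'
  rw [div_eq_div_iff hP hV]
  have h := Nat.choose_mul (n := m + 4) (k := i + 5) (s := 4) (by omega)
  rw [show m + 4 - 4 = m by omega, show i + 5 - 4 = i + 1 by omega] at h
  have h' : ((m + 4).choose (i + 5) : ℚ) * ((i + 5).choose 4 : ℚ) = ((m + 4).choose 4 : ℚ) * (m.choose (i + 1) : ℚ) := by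
    exact_mod_cast h
  linear_combination -h'

/-- `C(m,i+1)/C(i+6,5) = C(m+5, i+6)/C(m+5,5)`. -/
theorem ratio_2 (m i : ℕ) : (m.choose (i + 1) : ℚ) / ((i + 6).choose 5 : ℚ) = ((m + 5).choose (i + 6) : ℚ) / ((m + 5).choose 5 : ℚ) := by
  have hP : (((i + 6).choose 5 : ℕ) : ℚ) ≠ 0 := by exact_mod_cast (Nat.choose_pos (by omega)).ne'
  have hV : (((m + 5).choose 5 : ℕ) : ℚ) ≠ 0 := by exact_mod_cast (Nat.choose_pos (by omega)).ne'
  rw [div_eq_div_iff hP hV]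
  have h := Nat.choose_mul (n := m + 5) (k := i + 6) (s := 5) (by omega)
  rw [show m + 5 - 5 = m by omega, show i + 6 - 5 = i + 1 by omega] at h
  have h' : ((m + 5).choose (i + 6) : ℚ) * ((i + 6).choose 5 : ℚ) = ((m + 5).choose 5 : ℚ) * (m.choose (i + 1) : ℚ) := by
    exact_mod_cast h
  linear_combination -h'

/-- `C(m,i+1)/C(i+7,6) = C(m+6, i+7)/C(m+6,6)`. -/
theorem ratio_3 (m i : ℕ) : (m.choose (i + 1) : ℚ) / ((i + 7).choose 6 : ℚ) = ((m + 6).choose (i + 7) : ℚ) / ((m + 6).choose 6 : ℚ) := by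
  have hP : (((i + 7).choose 6 : ℕ) : ℚ) ≠ 0 := by exact_mod_cast (Nat.choose_pos (by omega)).ne'
  have hV : (((m + 6).choose 6 : ℕ) : ℚ) ≠ 0 := by exact_mod_cast (Nat.choose_pos (by omega)).ne'
  rw [div_eq_div_iff hP hV]
  have h := Nat.choose_mul (n := m + 6) (k := i + 7) (s := 6) (by omega)
  rw [show m + 6 - 6 = m by omega, show i + 7 - 6 = i + 1 by omega] at h
  have h' : ((m + 6).choose (i + 7) : ℚ) * ((i + 7).choose 6 : ℚ) = ((m + 6).choose 6 : ℚ) * (m.choose (i + 1) : ℚ) := by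
    exact_mod_cast h
  linear_combination -h'

/-- `C(m,i+1)/C(i+8,7) = C(m+7, i+8)/C(m+7,7)`. -/
theorem ratio_4 (m i : ℕ) : (m.choose (i + 1) : ℚ) / ((i + 8).choose 7 : ℚ) = ((m + 7).choose (i + 8) : ℚ) / ((m + 7).choose 7 : ℚ) := by
  have hP : (((i + 8).choose 7 : ℕ) : ℚ) ≠ 0 := by exact_mod_cast (Nat.choose_pos (by omega)).ne'
  have hV : (((m + 7).choose 7 : ℕ) : ℚ) ≠ 0 := by exact_mod_cast (Nat.choose_pos (by omega)).ne'
  rw [div_eq_div_iff hP hV]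
  have h := Nat.choose_mul (n := m + 7) (k := i + 8) (s := 7) (by omega)
  rw [show m + 7 - 7 = m by omega, show i + 8 - 7 = i + 1 by omega] at h
  have h' : ((m + 7).choose (i + 8) : ℚ) * ((i + 8).choose 7 : ℚ) = ((m + 7).choose 7 : ℚ) * (m.choose (i + 1) : ℚ) := by
    exact_mod_cast h
  linear_combination -h'

/-- `Σ_{i<n−2} C(n+3, i+4)` in closed form (`n ≥ 2`). -/
theorem level_0_0 (n : ℕ) (hn : 2 ≤ n) :
    (∑ i ∈ range (n - 2), ((n + 3).choose (i + 4) : ℚ)) = 2 ^ (n + 3) - (1 + ((n : ℚ) + 3) + ((n + 3).choose 2 : ℚ) + ((n + 3).choose 3 : ℚ)) - (1 + ((n : ℚ) + 3)) := by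
  rw [sum_choose_shift (n + 3) 4 (n - 2), sum_choose_Ico (n + 3) 4 (4 + (n - 2)) (by omega) (by omega)]
  have ht := sum_choose_tail (n + 3) 2 (by omega)
  rw [show n + 3 + 1 - 2 = 4 + (n - 2) by omega] at ht
  rw [ht, sum_range_four, sum_range_two]; push_cast; ring

/-- `Σ_{i<n−2} C(n+4, i+5)` in closed form (`n ≥ 2`). -/
theorem level_0_1 (n : ℕ) (hn : 2 ≤ n) :
    (∑ i ∈ range (n - 2), ((n + 4).choose (i + 5) : ℚ)) = 2 ^ (n + 4) - (1 + ((n : ℚ) + 4) + ((n + 4).choose 2 : ℚ) + ((n + 4).choose 3 : ℚ) + ((n + 4).choose 4 : ℚ)) - (1 + ((n : ℚ) + 4)) := by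
  rw [sum_choose_shift (n + 4) 5 (n - 2), sum_choose_Ico (n + 4) 5 (5 + (n - 2)) (by omega) (by omega)]
  have ht := sum_choose_tail (n + 4) 2 (by omega)
  rw [show n + 4 + 1 - 2 = 5 + (n - 2) by omega] at ht
  rw [ht, sum_range_five, sum_range_two]; push_cast; ring

/-- `Σ_{i<n−2} C(n+5, i+6)` in closed form (`n ≥ 2`). -/
theorem level_0_2 (n : ℕ) (hn : 2 ≤ n) :
    (∑ i ∈ range (n - 2), ((n + 5).choose (i + 6) : ℚ)) = 2 ^ (n + 5) - (1 + ((n : ℚ) + 5) + ((n + 5).choose 2 : ℚ) + ((n + 5).choose 3 : ℚ) + ((n + 5).choose 4 : ℚ) + ((n + 5).choose 5 : ℚ)) - (1 + ((n : ℚ) + 5)) := by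
  rw [sum_choose_shift (n + 5) 6 (n - 2), sum_choose_Ico (n + 5) 6 (6 + (n - 2)) (by omega) (by omega)]
  have ht := sum_choose_tail (n + 5) 2 (by omega)
  rw [show n + 5 + 1 - 2 = 6 + (n - 2) by omega] at ht
  rw [ht, sum_range_six, sum_range_two]; push_cast; ring

/-- `Σ_{i<n−2} C(n+6, i+7)` in closed form (`n ≥ 2`). -/
theorem level_0_3 (n : ℕ) (hn : 2 ≤ n) :
    (∑ i ∈ range (n - 2), ((n + 6).choose (i + 7) : ℚ)) = 2 ^ (n + 6) - (1 + ((n : ℚ) + 6) + ((n + 6).choose 2 : ℚ) + ((n + 6).choose 3 : ℚ) + ((n + 6).choose 4 : ℚ) + ((n + 6).choose 5 : ℚ) + ((n + 6).choose 6 : ℚ)) - (1 + ((n : ℚ) + 6)) := by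
  rw [sum_choose_shift (n + 6) 7 (n - 2), sum_choose_Ico (n + 6) 7 (7 + (n - 2)) (by omega) (by omega)]
  have ht := sum_choose_tail (n + 6) 2 (by omega)
  rw [show n + 6 + 1 - 2 = 7 + (n - 2) by omega] at ht
  rw [ht, sum_range_seven, sum_range_two]; push_cast; ring

/-- `Σ_{i<n−2} C(n+7, i+8)` in closed form (`n ≥ 2`). -/
theorem level_0_4 (n : ℕ) (hn : 2 ≤ n) :
    (∑ i ∈ range (n - 2), ((n + 7).choose (i + 8) : ℚ)) = 2 ^ (n + 7) - (1 + ((n : ℚ) + 7) + ((n + 7).choose 2 : ℚ) + ((n + 7).choose 3 : ℚ) + ((n + 7).choose 4 : ℚ) + ((n + 7).choose 5 : ℚ) + ((n + 7).choose 6 : ℚ) + ((n + 7).choose 7 : ℚ)) - (1 + ((n : ℚ) + 7)) := by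
  rw [sum_choose_shift (n + 7) 8 (n - 2), sum_choose_Ico (n + 7) 8 (8 + (n - 2)) (by omega) (by omega)]
  have ht := sum_choose_tail (n + 7) 2 (by omega)
  rw [show n + 7 + 1 - 2 = 8 + (n - 2) by omega] at ht
  rw [ht, sum_range_eight, sum_range_two]; push_cast; ring

/-- `Σ_{i<n−2} C(n+4, i+4)` in closed form (`n ≥ 2`). -/
theorem level_1_0 (n : ℕ) (hn : 2 ≤ n) :
    (∑ i ∈ range (n - 2), ((n + 4).choose (i + 4) : ℚ)) = 2 ^ (n + 4) - (1 + ((n : ℚ) + 4) + ((n + 4).choose 2 : ℚ) + ((n + 4).choose 3 : ℚ)) - (1 + ((n : ℚ) + 4) + ((n + 4).choose 2 : ℚ)) := by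
  rw [sum_choose_shift (n + 4) 4 (n - 2), sum_choose_Ico (n + 4) 4 (4 + (n - 2)) (by omega) (by omega)]
  have ht := sum_choose_tail (n + 4) 3 (by omega)
  rw [show n + 4 + 1 - 3 = 4 + (n - 2) by omega] at ht
  rw [ht, sum_range_four, sum_range_three]; push_cast; ring

/-- `Σ_{i<n−2} C(n+5, i+5)` in closed form (`n ≥ 2`). -/
theorem level_1_1 (n : ℕ) (hn : 2 ≤ n) :
    (∑ i ∈ range (n - 2), ((n + 5).choose (i + 5) : ℚ)) = 2 ^ (n + 5) - (1 + ((n : ℚ) + 5) + ((n + 5).choose 2 : ℚ) + ((n + 5).choose 3 : ℚ) + ((n + 5).choose 4 : ℚ)) - (1 + ((n : ℚ) + 5) + ((n + 5).choose 2 : ℚ)) := by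
  rw [sum_choose_shift (n + 5) 5 (n - 2), sum_choose_Ico (n + 5) 5 (5 + (n - 2)) (by omega) (by omega)]
  have ht := sum_choose_tail (n + 5) 3 (by omega)
  rw [show n + 5 + 1 - 3 = 5 + (n - 2) by omega] at ht
  rw [ht, sum_range_five, sum_range_three]; push_cast; ring

/-- `Σ_{i<n−2} C(n+6, i+6)` in closed form (`n ≥ 2`). -/
theorem level_1_2 (n : ℕ) (hn : 2 ≤ n) :
    (∑ i ∈ range (n - 2), ((n + 6).choose (i + 6) : ℚ)) = 2 ^ (n + 6) - (1 + ((n : ℚ) + 6) + ((n + 6).choose 2 : ℚ) + ((n + 6).choose 3 : ℚ) + ((n + 6).choose 4 : ℚ) + ((n + 6).choose 5 : ℚ)) - (1 + ((n : ℚ) + 6) + ((n + 6).choose 2 : ℚ)) := by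
  rw [sum_choose_shift (n + 6) 6 (n - 2), sum_choose_Ico (n + 6) 6 (6 + (n - 2)) (by omega) (by omega)]
  have ht := sum_choose_tail (n + 6) 3 (by omega)
  rw [show n + 6 + 1 - 3 = 6 + (n - 2) by omega] at ht
  rw [ht, sum_range_six, sum_range_three]; push_cast; ring

/-- `Σ_{i<n−2} C(n+7, i+7)` in closed form (`n ≥ 2`). -/
theorem level_1_3 (n : ℕ) (hn : 2 ≤ n) :
    (∑ i ∈ range (n - 2), ((n + 7).choose (i + 7) : ℚ)) = 2 ^ (n + 7) - (1 + ((n : ℚ) + 7) + ((n + 7).choose 2 : ℚ) + ((n + 7).choose 3 : ℚ) + ((n + 7).choose 4 : ℚ) + ((n + 7).choose 5 : ℚ) + ((n + 7).choose 6 : ℚ)) - (1 + ((n : ℚ) + 7) + ((n + 7).choose 2 : ℚ)) := by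
  rw [sum_choose_shift (n + 7) 7 (n - 2), sum_choose_Ico (n + 7) 7 (7 + (n - 2)) (by omega) (by omega)]
  have ht := sum_choose_tail (n + 7) 3 (by omega)
  rw [show n + 7 + 1 - 3 = 7 + (n - 2) by omega] at ht
  rw [ht, sum_range_seven, sum_range_three]; push_cast; ring

/-- `Σ_{i<n−2} C(n+8, i+8)` in closed form (`n ≥ 2`). -/
theorem level_1_4 (n : ℕ) (hn : 2 ≤ n) :
    (∑ i ∈ range (n - 2), ((n + 8).choose (i + 8) : ℚ)) = 2 ^ (n + 8) - (1 + ((n : ℚ) + 8) + ((n + 8).choose 2 : ℚ) + ((n + 8).choose 3 : ℚ) + ((n + 8).choose 4 : ℚ) + ((n + 8).choose 5 : ℚ) + ((n + 8).choose 6 : ℚ) + ((n + 8).choose 7 : ℚ)) - (1 + ((n : ℚ) + 8) + ((n + 8).choose 2 : ℚ)) := by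
  rw [sum_choose_shift (n + 8) 8 (n - 2), sum_choose_Ico (n + 8) 8 (8 + (n - 2)) (by omega) (by omega)]
  have ht := sum_choose_tail (n + 8) 3 (by omega)
  rw [show n + 8 + 1 - 3 = 8 + (n - 2) by omega] at ht
  rw [ht, sum_range_eight, sum_range_three]; push_cast; ring

/-- The class-witness count: `Σ_{x=3}^{p−4} C(p−4, x−3)` (`= Σ_{i<n−2} C(n,i)`). -/
def cwSum (n : ℕ) : ℚ := ∑ i ∈ range (n - 2), (n.choose i : ℚ)

/-- `cwSum n = 2^n − C(n,2) − n − 1` (`n ≥ 2`). -/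
theorem cw_closed (n : ℕ) (hn : 2 ≤ n) : cwSum n = 2 ^ n - (n.choose 2 : ℚ) - n - 1 := by
  unfold cwSum
  rw [range_eq_Ico, sum_choose_Ico n 0 (n - 2) (by omega) (by omega)]
  have ht := sum_choose_tail n 3 (by omega)
  rw [show n + 1 - 3 = n - 2 by omega] at ht
  rw [ht, sum_range_three]; simp; ring

/-- `Σ_{x=3}^{p−4} C(p−4,x−3)/C(x+4,3)` (`x = i + 3`): the lost pure share of a lined 4-set over the class. -/
def ct4Sum (n : ℕ) : ℚ := ∑ i ∈ range (n - 2), (n.choose i : ℚ) / ((i + 7).choose 3 : ℚ)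

/-- `Σ_{x=3}^{p−4} C(p−4,x−3)/C(x+5,3)`: the lost pure share of a 5-set over the class. -/
def ct5Sum (n : ℕ) : ℚ := ∑ i ∈ range (n - 2), (n.choose i : ℚ) / ((i + 8).choose 3 : ℚ)

/-- Pascal split: `Σ_{i<n−2} C(n,i) f i = Σ C(n+1,i+1) f i − Σ C(n,i+1) f i`. -/
theorem pascal_split (n : ℕ) (f : ℕ → ℚ) :
    (∑ i ∈ range (n - 2), (n.choose i : ℚ) * f i) =
      (∑ i ∈ range (n - 2), ((n + 1).choose (i + 1) : ℚ) * f i) - ∑ i ∈ range (n - 2), (n.choose (i + 1) : ℚ) * f i := by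
  rw [← sum_sub_distrib]
  apply sum_congr rfl
  intro i _
  rw [Nat.choose_succ_succ']; push_cast; ring

/-- `Σ_{i<n−2} C(n, i+1)/C(i+7,3)` in closed form (`n ≥ 2`). -/
theorem texp_7_0 (n : ℕ) (hn : 2 ≤ n) :
    (∑ i ∈ range (n - 2), (n.choose (i + 1) : ℚ) / ((i + 7).choose 3 : ℚ)) = (1 : ℚ) * ((2 ^ (n + 3) - (1 + ((n : ℚ) + 3) + ((n + 3).choose 2 : ℚ) + ((n + 3).choose 3 : ℚ)) - (1 + ((n : ℚ) + 3))) / ((n + 3).choose 3 : ℚ)) + (-(9/4) : ℚ) * ((2 ^ (n + 4) - (1 + ((n : ℚ) + 4) + ((n + 4).choose 2 : ℚ) + ((n + 4).choose 3 : ℚ) + ((n + 4).choose 4 : ℚ)) - (1 + ((n : ℚ) + 4))) / ((n + 4).choose 4 : ℚ)) + (9/5 : ℚ) * ((2 ^ (n + 5) - (1 + ((n : ℚ) + 5) + ((n + 5).choose 2 : ℚ) + ((n + 5).choose 3 : ℚ) + ((n + 5).choose 4 : ℚ) + ((n + 5).choose 5 : ℚ)) - (1 + ((n : ℚ) + 5)))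 / ((n + 5).choose 5 : ℚ)) + (-(1/2) : ℚ) * ((2 ^ (n + 6) - (1 + ((n : ℚ) + 6) + ((n + 6).choose 2 : ℚ) + ((n + 6).choose 3 : ℚ) + ((n + 6).choose 4 : ℚ) + ((n + 6).choose 5 : ℚ) + ((n + 6).choose 6 : ℚ)) - (1 + ((n : ℚ) + 6))) / ((n + 6).choose 6 : ℚ)) := by
  have hterm : ∀ i ∈ range (n - 2), (n.choose (i + 1) : ℚ) / ((i + 7).choose 3 : ℚ) =
      (1 : ℚ) * (((n + 3).choose (i + 4) : ℚ) / ((n + 3).choose 3 : ℚ)) + (-(9/4) : ℚ) * (((n + 4).choose (i + 5) : ℚ) / ((n + 4).choose 4 : ℚ)) + (9/5 : ℚ) * (((n + 5).choose (i + 6) : ℚ) / ((n + 5).choose 5 : ℚ)) + (-(1/2) : ℚ) * (((n + 6).choose (i + 7) : ℚ) / ((n + 6).choose 6 : ℚ)) := by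
    intro i _
    rw [div_eq_mul_one_div, inv_choose_7, ← ratio_0 n, ← ratio_1 n, ← ratio_2 n, ← ratio_3 n]; ring
  rw [sum_congr rfl hterm]
  simp only [sum_add_distrib, ← mul_sum, ← sum_div]
  rw [level_0_0 n hn, level_0_1 n hn, level_0_2 n hn, level_0_3 n hn]

/-- `Σ_{i<n−2} C(n + 1, i+1)/C(i+7,3)` in closed form (`n ≥ 2`). -/
theorem texp_7_1 (n : ℕ) (hn : 2 ≤ n) :
    (∑ i ∈ range (n - 2), ((n + 1).choose (i + 1) : ℚ) / ((i + 7).choose 3 : ℚ)) = (1 : ℚ) * ((2 ^ (n + 4) - (1 + ((n : ℚ) + 4) + ((n + 4).choose 2 : ℚ) + ((n + 4).choose 3 : ℚ)) - (1 + ((n : ℚ) + 4) + ((n + 4).choose 2 : ℚ))) / ((n + 4).choose 3 : ℚ)) + (-(9/4) : ℚ) * ((2 ^ (n + 5) - (1 + ((n : ℚ) + 5) + ((n + 5).choose 2 : ℚ) + ((n + 5).choose 3 : ℚ) + ((n + 5).choose 4 : ℚ)) - (1 + ((n : ℚ) + 5) + ((n + 5).choose 2 : ℚ))) / ((n + 5).choose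 4 : ℚ)) + (9/5 : ℚ) * ((2 ^ (n + 6) - (1 + ((n : ℚ) + 6) + ((n + 6).choose 2 : ℚ) + ((n + 6).choose 3 : ℚ) + ((n + 6).choose 4 : ℚ) + ((n + 6).choose 5 : ℚ)) - (1 + ((n : ℚ) + 6) + ((n + 6).choose 2 : ℚ))) / ((n + 6).choose 5 : ℚ)) + (-(1/2) : ℚ) * ((2 ^ (n + 7) - (1 + ((n : ℚ) + 7) + ((n + 7).choose 2 : ℚ) + ((n + 7).choose 3 : ℚ) + ((n + 7).choose 4 : ℚ) + ((n + 7).choose 5 : ℚ) + ((n + 7).choose 6 : ℚ)) - (1 + ((n : ℚ) + 7) + ((n + 7).choose 2 : ℚ))) / ((n + 7).choose 6 : ℚ)) := by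
  have hterm : ∀ i ∈ range (n - 2), ((n + 1).choose (i + 1) : ℚ) / ((i + 7).choose 3 : ℚ) =
      (1 : ℚ) * ((((n + 1) + 3).choose (i + 4) : ℚ) / (((n + 1) + 3).choose 3 : ℚ)) + (-(9/4) : ℚ) * ((((n + 1) + 4).choose (i + 5) : ℚ) / (((n + 1) + 4).choose 4 : ℚ)) + (9/5 : ℚ) * ((((n + 1) + 5).choose (i + 6) : ℚ) / (((n + 1) + 5).choose 5 : ℚ)) + (-(1/2) : ℚ) * ((((n + 1) + 6).choose (i + 7) : ℚ) / (((n + 1) + 6).choose 6 : ℚ)) := by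
    intro i _
    rw [div_eq_mul_one_div, inv_choose_7, ← ratio_0 (n + 1), ← ratio_1 (n + 1), ← ratio_2 (n + 1), ← ratio_3 (n + 1)]; ring
  rw [sum_congr rfl hterm]
  simp only [sum_add_distrib, ← mul_sum, ← sum_div]
  rw [level_1_0 n hn, level_1_1 n hn, level_1_2 n hn, level_1_3 n hn]

/-- `Σ_{i<n−2} C(n, i+1)/C(i+8,3)` in closed form (`n ≥ 2`). -/
theorem texp_8_0 (n : ℕ) (hn : 2 ≤ n) :
    (∑ i ∈ range (n - 2), (n.choose (i + 1) : ℚ) / ((i + 8).choose 3 : ℚ)) = (1 : ℚ) * ((2 ^ (n + 3) - (1 + ((n : ℚ) + 3) + ((n + 3).choose 2 : ℚ) + ((n + 3).choose 3 : ℚ)) - (1 + ((n : ℚ) + 3))) / ((n + 3).choose 3 : ℚ)) + (-3 : ℚ) * ((2 ^ (n + 4) - (1 + ((n : ℚ) + 4) + ((n + 4).choose 2 : ℚ) + ((n + 4).choose 3 : ℚ) + ((n + 4).choose 4 : ℚ)) - (1 + ((n : ℚ) + 4))) / ((n + 4).choose 4 : ℚ)) + (18/5 : ℚ) * ((2 ^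 (n + 5) - (1 + ((n : ℚ) + 5) + ((n + 5).choose 2 : ℚ) + ((n + 5).choose 3 : ℚ) + ((n + 5).choose 4 : ℚ) + ((n + 5).choose 5 : ℚ)) - (1 + ((n : ℚ) + 5))) / ((n + 5).choose 5 : ℚ)) + (-2 : ℚ) * ((2 ^ (n + 6) - (1 + ((n : ℚ) + 6) + ((n + 6).choose 2 : ℚ) + ((n + 6).choose 3 : ℚ) + ((n + 6).choose 4 : ℚ) + ((n + 6).choose 5 : ℚ) + ((n + 6).choose 6 : ℚ)) - (1 + ((n : ℚ) + 6))) / ((n + 6).choose 6 : ℚ)) + (3/7 : ℚ) * ((2 ^ (n + 7) - (1 + ((n : ℚ) + 7) + ((n + 7).choose 2 : ℚ) + ((n + 7).choose 3 : ℚ) + ((n + 7).choose 4 : ℚ) + ((n + 7).choose 5 : ℚ) + ((n + 7).choose 6 : ℚ) + ((n + 7).choose 7 : ℚ)) - (1 + ((n : ℚ) + 7))) / ((n + 7).choose 7 : ℚ)) := by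
  have hterm : ∀ i ∈ range (n - 2), (n.choose (i + 1) : ℚ) / ((i + 8).choose 3 : ℚ) =
      (1 : ℚ) * (((n + 3).choose (i + 4) : ℚ) / ((n + 3).choose 3 : ℚ)) + (-3 : ℚ) * (((n + 4).choose (i + 5) : ℚ) / ((n + 4).choose 4 : ℚ)) + (18/5 : ℚ) * (((n + 5).choose (i + 6) : ℚ) / ((n + 5).choose 5 : ℚ)) + (-2 : ℚ) * (((n + 6).choose (i + 7) : ℚ) / ((n + 6).choose 6 : ℚ)) + (3/7 : ℚ) * (((n + 7).choose (i + 8) : ℚ) / ((n + 7).choose 7 : ℚ)) := by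
    intro i _
    rw [div_eq_mul_one_div, inv_choose_8, ← ratio_0 n, ← ratio_1 n, ← ratio_2 n, ← ratio_3 n, ← ratio_4 n]; ring
  rw [sum_congr rfl hterm]
  simp only [sum_add_distrib, ← mul_sum, ← sum_div]
  rw [level_0_0 n hn, level_0_1 n hn, level_0_2 n hn, level_0_3 n hn, level_0_4 n hn]

/-- `Σ_{i<n−2} C(n + 1, i+1)/C(i+8,3)` in closed form (`n ≥ 2`). -/
theorem texp_8_1 (n : ℕ) (hn : 2 ≤ n) :
    (∑ i ∈ range (n - 2), ((n + 1).choose (i + 1) : ℚ) / ((i + 8).choose 3 : ℚ)) = (1 : ℚ) * ((2 ^ (n + 4) - (1 + ((n : ℚ) + 4) + ((n + 4).choose 2 : ℚ) + ((n + 4).choose 3 : ℚ)) - (1 + ((n : ℚ) + 4) + ((n + 4).choose 2 : ℚ))) / ((n + 4).choose 3 : ℚ)) + (-3 : ℚ) * ((2 ^ (n + 5) - (1 + ((n : ℚ) + 5) + ((n + 5).choose 2 : ℚ) + ((n + 5).choose 3 : ℚ) + ((n + 5).choose 4 : ℚ)) - (1 + ((n : ℚ) + 5) + ((n + 5).choose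 2 : ℚ))) / ((n + 5).choose 4 : ℚ)) + (18/5 : ℚ) * ((2 ^ (n + 6) - (1 + ((n : ℚ) + 6) + ((n + 6).choose 2 : ℚ) + ((n + 6).choose 3 : ℚ) + ((n + 6).choose 4 : ℚ) + ((n + 6).choose 5 : ℚ)) - (1 + ((n : ℚ) + 6) + ((n + 6).choose 2 : ℚ))) / ((n + 6).choose 5 : ℚ)) + (-2 : ℚ) * ((2 ^ (n + 7) - (1 + ((n : ℚ) + 7) + ((n + 7).choose 2 : ℚ) + ((n + 7).choose 3 : ℚ) + ((n + 7).choose 4 : ℚ) + ((n + 7).choose 5 : ℚ) + ((n + 7).choose 6 : ℚ)) - (1 + ((n : ℚ) + 7) + ((n + 7).choose 2 : ℚ))) / ((n + 7).choose 6 : ℚ)) + (3/7 : ℚ) * ((2 ^ (n + 8) - (1 + ((n : ℚ) + 8) + ((n + 8).choose 2 : ℚ) + ((n + 8).choose 3 : ℚ) + ((n + 8).choose 4 : ℚ) + ((n + 8).choose 5 : ℚ) + ((n + 8).choose 6 : ℚ) + ((n + 8).choose 7 : ℚ)) - (1 + ((n : ℚ) + 8) + ((n + 8).choose 2 : ℚ)))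 / ((n + 8).choose 7 : ℚ)) := by
  have hterm : ∀ i ∈ range (n - 2), ((n + 1).choose (i + 1) : ℚ) / ((i + 8).choose 3 : ℚ) =
      (1 : ℚ) * ((((n + 1) + 3).choose (i + 4) : ℚ) / (((n + 1) + 3).choose 3 : ℚ)) + (-3 : ℚ) * ((((n + 1) + 4).choose (i + 5) : ℚ) / (((n + 1) + 4).choose 4 : ℚ)) + (18/5 : ℚ) * ((((n + 1) + 5).choose (i + 6) : ℚ) / (((n + 1) + 5).choose 5 : ℚ)) + (-2 : ℚ) * ((((n + 1) + 6).choose (i + 7) : ℚ) / (((n + 1) + 6).choose 6 : ℚ)) + (3/7 : ℚ) * ((((n + 1) + 7).choose (i + 8) : ℚ) / (((n + 1) + 7).choose 7 : ℚ)) := by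
    intro i _
    rw [div_eq_mul_one_div, inv_choose_8, ← ratio_0 (n + 1), ← ratio_1 (n + 1), ← ratio_2 (n + 1), ← ratio_3 (n + 1), ← ratio_4 (n + 1)]; ring
  rw [sum_congr rfl hterm]
  simp only [sum_add_distrib, ← mul_sum, ← sum_div]
  rw [level_1_0 n hn, level_1_1 n hn, level_1_2 n hn, level_1_3 n hn, level_1_4 n hn]

/-- `ct4Sum` after the Pascal split. -/
theorem ct4_closed (n : ℕ) :
    ct4Sum n = (∑ i ∈ range (n - 2), ((n + 1).choose (i + 1) : ℚ) / ((i + 7).choose 3 : ℚ)) - ∑ i ∈ range (n - 2), (n.choose (i + 1) : ℚ) / ((i + 7).choose 3 : ℚ) := by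
  unfold ct4Sum
  have := pascal_split n (fun i => 1 / ((i + 7).choose 3 : ℚ))
  simp only [mul_one_div] at this
  exact this

/-- `ct5Sum` after the Pascal split. -/
theorem ct5_closed (n : ℕ) :
    ct5Sum n = (∑ i ∈ range (n - 2), ((n + 1).choose (i + 1) : ℚ) / ((i + 8).choose 3 : ℚ)) - ∑ i ∈ range (n - 2), (n.choose (i + 1) : ℚ) / ((i + 8).choose 3 : ℚ) := by
  unfold ct5Sum
  have := pascal_split n (fun i => 1 / ((i + 8).choose 3 : ℚ))
  simp only [mul_one_div] at this
  exact this

/-- `cwSum` as an explicit rational function. -/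
def cwP (n : ℕ) : ℚ := 2 ^ n - (n : ℚ) * ((n : ℚ) - 1) / 2 - n - 1

/-- `ct4Sum` as an explicit rational function. -/
def ct4P (n : ℕ) : ℚ := ((1 : ℚ) * ((16 * 2 ^ n - (1 + ((n : ℚ) + 4) + (((n : ℚ) + 4) * ((n : ℚ) + 3) / 2) + (((n : ℚ) + 4) * ((n : ℚ) + 3) * ((n : ℚ) + 2) / 6)) - (1 + ((n : ℚ) + 4) + (((n : ℚ) + 4) * ((n : ℚ) + 3) / 2))) / (((n : ℚ) + 4) * ((n : ℚ) + 3) * ((n : ℚ) + 2) / 6)) + (-(9/4) : ℚ) * ((32 * 2 ^ n - (1 + ((n : ℚ) + 5) + (((n : ℚ) + 5) * ((n : ℚ) + 4) / 2) + (((n : ℚ) + 5) * ((n : ℚ) + 4) * ((n : ℚ) + 3) / 6) + (((n : ℚ) + 5) * ((n : ℚ) + 4) * ((n : ℚ) + 3) * ((n : ℚ) + 2) / 24)) - (1 + ((n : ℚ) + 5) + (((n : ℚ) + 5) * ((n : ℚ) + 4) / 2))) / (((n : ℚ) + 5) * ((n : ℚ) + 4) * ((n : ℚ) + 3) * ((n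 : ℚ) + 2) / 24)) + (9/5 : ℚ) * ((64 * 2 ^ n - (1 + ((n : ℚ) + 6) + (((n : ℚ) + 6) * ((n : ℚ) + 5) / 2) + (((n : ℚ) + 6) * ((n : ℚ) + 5) * ((n : ℚ) + 4) / 6) + (((n : ℚ) + 6) * ((n : ℚ) + 5) * ((n : ℚ) + 4) * ((n : ℚ) + 3) / 24) + (((n : ℚ) + 6) * ((n : ℚ) + 5) * ((n : ℚ) + 4) * ((n : ℚ) + 3) * ((n : ℚ) + 2) / 120)) - (1 + ((n : ℚ) + 6) + (((n : ℚ) + 6) * ((n : ℚ) + 5) / 2))) / (((n : ℚ) + 6) * ((n : ℚ) + 5) * ((n : ℚ) + 4) * ((n : ℚ) + 3) * ((n : ℚ) + 2) / 120)) + (-(1/2) : ℚ) * ((128 * 2 ^ n - (1 + ((n : ℚ) + 7) + (((n : ℚ) + 7) * ((n : ℚ) + 6) / 2) + (((n : ℚ) + 7) * ((n : ℚ) + 6) * ((n : ℚ) + 5) / 6) + (((n : ℚ) + 7) * ((n : ℚ) + 6) * ((n : ℚ) + 5) * ((n : ℚ) + 4) / 24) + (((n : ℚ) + 7) * ((n :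 ℚ) + 6) * ((n : ℚ) + 5) * ((n : ℚ) + 4) * ((n : ℚ) + 3) / 120) + (((n : ℚ) + 7) * ((n : ℚ) + 6) * ((n : ℚ) + 5) * ((n : ℚ) + 4) * ((n : ℚ) + 3) * ((n : ℚ) + 2) / 720)) - (1 + ((n : ℚ) + 7) + (((n : ℚ) + 7) * ((n : ℚ) + 6) / 2))) / (((n : ℚ) + 7) * ((n : ℚ) + 6) * ((n : ℚ) + 5) * ((n : ℚ) + 4) * ((n : ℚ) + 3) * ((n : ℚ) + 2) / 720))) - ((1 : ℚ) * ((8 * 2 ^ n - (1 + ((n : ℚ) + 3) + (((n : ℚ) + 3) * ((n : ℚ) + 2) / 2) + (((n : ℚ) + 3) * ((n : ℚ) + 2) * ((n : ℚ) + 1) / 6)) - (1 + ((n : ℚ) + 3))) / (((n : ℚ) + 3) * ((n : ℚ) + 2) * ((n : ℚ) + 1) / 6)) + (-(9/4) : ℚ) * ((16 * 2 ^ n - (1 + ((n : ℚ) + 4) + (((n : ℚ) + 4) * ((n : ℚ) + 3) / 2) + (((n : ℚ) + 4) * ((n : ℚ) + 3) * ((n : ℚ) + 2) / 6) + (((n :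 ℚ) + 4) * ((n : ℚ) + 3) * ((n : ℚ) + 2) * ((n : ℚ) + 1) / 24)) - (1 + ((n : ℚ) + 4))) / (((n : ℚ) + 4) * ((n : ℚ) + 3) * ((n : ℚ) + 2) * ((n : ℚ) + 1) / 24)) + (9/5 : ℚ) * ((32 * 2 ^ n - (1 + ((n : ℚ) + 5) + (((n : ℚ) + 5) * ((n : ℚ) + 4) / 2) + (((n : ℚ) + 5) * ((n : ℚ) + 4) * ((n : ℚ) + 3) / 6) + (((n : ℚ) + 5) * ((n : ℚ) + 4) * ((n : ℚ) + 3) * ((n : ℚ) + 2) / 24) + (((n : ℚ) + 5) * ((n : ℚ) + 4) * ((n : ℚ) + 3) * ((n : ℚ) + 2) * ((n : ℚ) + 1) / 120)) - (1 + ((n : ℚ) + 5))) / (((n : ℚ) + 5) * ((n : ℚ) + 4) * ((n : ℚ) + 3) * ((n : ℚ) + 2) * ((n : ℚ) + 1) / 120)) + (-(1/2) : ℚ) * ((64 * 2 ^ n - (1 + ((n : ℚ) + 6) + (((n : ℚ) + 6) * ((n : ℚ) + 5) / 2) + (((n : ℚ) + 6) * ((n : ℚ) + 5) * ((n : ℚ)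 + 4) / 6) + (((n : ℚ) + 6) * ((n : ℚ) + 5) * ((n : ℚ) + 4) * ((n : ℚ) + 3) / 24) + (((n : ℚ) + 6) * ((n : ℚ) + 5) * ((n : ℚ) + 4) * ((n : ℚ) + 3) * ((n : ℚ) + 2) / 120) + (((n : ℚ) + 6) * ((n : ℚ) + 5) * ((n : ℚ) + 4) * ((n : ℚ) + 3) * ((n : ℚ) + 2) * ((n : ℚ) + 1) / 720)) - (1 + ((n : ℚ) + 6))) / (((n : ℚ) + 6) * ((n : ℚ) + 5) * ((n : ℚ) + 4) * ((n : ℚ) + 3) * ((n : ℚ) + 2) * ((n : ℚ) + 1) / 720)))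

/-- `ct5Sum` as an explicit rational function. -/
def ct5P (n : ℕ) : ℚ := ((1 : ℚ) * ((16 * 2 ^ n - (1 + ((n : ℚ) + 4) + (((n : ℚ) + 4) * ((n : ℚ) + 3) / 2) + (((n : ℚ) + 4) * ((n : ℚ) + 3) * ((n : ℚ) + 2) / 6)) - (1 + ((n : ℚ) + 4) + (((n : ℚ) + 4) * ((n : ℚ) + 3) / 2))) / (((n : ℚ) + 4) * ((n : ℚ) + 3) * ((n : ℚ) + 2) / 6)) + (-3 : ℚ) * ((32 * 2 ^ n - (1 + ((n : ℚ) + 5) + (((n : ℚ) + 5) * ((n : ℚ) + 4) / 2) + (((n : ℚ) + 5) * ((n : ℚ) + 4) * ((n : ℚ) + 3) / 6) + (((n : ℚ) + 5) * ((n : ℚ) + 4) * ((n : ℚ) + 3) * ((n : ℚ) + 2) / 24)) - (1 + ((n : ℚ) + 5) + (((n : ℚ) + 5) * ((n : ℚ) + 4) / 2))) / (((n : ℚ) + 5) * ((n : ℚ) + 4) * ((n : ℚ) + 3) * ((n : ℚ) + 2) / 24)) + (18/5 : ℚ) * ((64 * 2 ^ n - (1 + ((n : ℚ) + 6) + (((n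 : ℚ) + 6) * ((n : ℚ) + 5) / 2) + (((n : ℚ) + 6) * ((n : ℚ) + 5) * ((n : ℚ) + 4) / 6) + (((n : ℚ) + 6) * ((n : ℚ) + 5) * ((n : ℚ) + 4) * ((n : ℚ) + 3) / 24) + (((n : ℚ) + 6) * ((n : ℚ) + 5) * ((n : ℚ) + 4) * ((n : ℚ) + 3) * ((n : ℚ) + 2) / 120)) - (1 + ((n : ℚ) + 6) + (((n : ℚ) + 6) * ((n : ℚ) + 5) / 2))) / (((n : ℚ) + 6) * ((n : ℚ) + 5) * ((n : ℚ) + 4) * ((n : ℚ) + 3) * ((n : ℚ) + 2) / 120)) + (-2 : ℚ) * ((128 * 2 ^ n - (1 + ((n : ℚ) + 7) + (((n : ℚ) + 7) * ((n : ℚ) + 6) / 2) + (((n : ℚ) + 7) * ((n : ℚ) + 6) * ((n : ℚ) + 5) / 6) + (((n : ℚ) + 7) * ((n : ℚ) + 6) * ((n : ℚ) + 5) * ((n : ℚ) + 4) / 24) + (((n : ℚ) + 7) * ((n : ℚ) + 6) * ((n : ℚ) + 5) * ((n : ℚ) + 4) * ((n : ℚ) + 3) / 120) + (((n : ℚ)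 + 7) * ((n : ℚ) + 6) * ((n : ℚ) + 5) * ((n : ℚ) + 4) * ((n : ℚ) + 3) * ((n : ℚ) + 2) / 720)) - (1 + ((n : ℚ) + 7) + (((n : ℚ) + 7) * ((n : ℚ) + 6) / 2))) / (((n : ℚ) + 7) * ((n : ℚ) + 6) * ((n : ℚ) + 5) * ((n : ℚ) + 4) * ((n : ℚ) + 3) * ((n : ℚ) + 2) / 720)) + (3/7 : ℚ) * ((256 * 2 ^ n - (1 + ((n : ℚ) + 8) + (((n : ℚ) + 8) * ((n : ℚ) + 7) / 2) + (((n : ℚ) + 8) * ((n : ℚ) + 7) * ((n : ℚ) + 6) / 6) + (((n : ℚ) + 8) * ((n : ℚ) + 7) * ((n : ℚ) + 6) * ((n : ℚ) + 5) / 24) + (((n : ℚ) + 8) * ((n : ℚ) + 7) * ((n : ℚ) + 6) * ((n : ℚ) + 5) * ((n : ℚ) + 4) / 120) + (((n : ℚ) + 8) * ((n : ℚ) + 7) * ((n : ℚ) + 6) * ((n : ℚ) + 5) * ((n : ℚ) + 4) * ((n : ℚ) + 3) / 720) + (((n : ℚ) + 8) * ((n : ℚ) + 7) * ((n : ℚ)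 + 6) * ((n : ℚ) + 5) * ((n : ℚ) + 4) * ((n : ℚ) + 3) * ((n : ℚ) + 2) / 5040)) - (1 + ((n : ℚ) + 8) + (((n : ℚ) + 8) * ((n : ℚ) + 7) / 2))) / (((n : ℚ) + 8) * ((n : ℚ) + 7) * ((n : ℚ) + 6) * ((n : ℚ) + 5) * ((n : ℚ) + 4) * ((n : ℚ) + 3) * ((n : ℚ) + 2) / 5040))) - ((1 : ℚ) * ((8 * 2 ^ n - (1 + ((n : ℚ) + 3) + (((n : ℚ) + 3) * ((n : ℚ) + 2) / 2) + (((n : ℚ) + 3) * ((n : ℚ) + 2) * ((n : ℚ) + 1) / 6)) - (1 + ((n : ℚ) + 3))) / (((n : ℚ) + 3) * ((n : ℚ) + 2) * ((n : ℚ) + 1) / 6)) + (-3 : ℚ) * ((16 * 2 ^ n - (1 + ((n : ℚ) + 4) + (((n : ℚ) + 4) * ((n : ℚ) + 3) / 2) + (((n : ℚ) + 4) * ((n : ℚ) + 3) * ((n : ℚ) + 2) / 6) + (((n : ℚ) + 4) * ((n : ℚ) + 3) * ((n : ℚ) + 2) * ((n : ℚ) + 1) / 24)) - (1 + ((n : ℚ)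 + 4))) / (((n : ℚ) + 4) * ((n : ℚ) + 3) * ((n : ℚ) + 2) * ((n : ℚ) + 1) / 24)) + (18/5 : ℚ) * ((32 * 2 ^ n - (1 + ((n : ℚ) + 5) + (((n : ℚ) + 5) * ((n : ℚ) + 4) / 2) + (((n : ℚ) + 5) * ((n : ℚ) + 4) * ((n : ℚ) + 3) / 6) + (((n : ℚ) + 5) * ((n : ℚ) + 4) * ((n : ℚ) + 3) * ((n : ℚ) + 2) / 24) + (((n : ℚ) + 5) * ((n : ℚ) + 4) * ((n : ℚ) + 3) * ((n : ℚ) + 2) * ((n : ℚ) + 1) / 120)) - (1 + ((n : ℚ) + 5))) / (((n : ℚ) + 5) * ((n : ℚ) + 4) * ((n : ℚ) + 3) * ((n : ℚ) + 2) * ((n : ℚ) + 1) / 120)) + (-2 : ℚ) * ((64 * 2 ^ n - (1 + ((n : ℚ) + 6) + (((n : ℚ) + 6) * ((n : ℚ) + 5) / 2) + (((n : ℚ) + 6) * ((n : ℚ) + 5) * ((n : ℚ) + 4) / 6) + (((n : ℚ) + 6) * ((n : ℚ) + 5) * ((n : ℚ) + 4) * ((n : ℚ) + 3) / 24) + (((n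 : ℚ) + 6) * ((n : ℚ) + 5) * ((n : ℚ) + 4) * ((n : ℚ) + 3) * ((n : ℚ) + 2) / 120) + (((n : ℚ) + 6) * ((n : ℚ) + 5) * ((n : ℚ) + 4) * ((n : ℚ) + 3) * ((n : ℚ) + 2) * ((n : ℚ) + 1) / 720)) - (1 + ((n : ℚ) + 6))) / (((n : ℚ) + 6) * ((n : ℚ) + 5) * ((n : ℚ) + 4) * ((n : ℚ) + 3) * ((n : ℚ) + 2) * ((n : ℚ) + 1) / 720)) + (3/7 : ℚ) * ((128 * 2 ^ n - (1 + ((n : ℚ) + 7) + (((n : ℚ) + 7) * ((n : ℚ) + 6) / 2) + (((n : ℚ) + 7) * ((n : ℚ) + 6) * ((n : ℚ) + 5) / 6) + (((n : ℚ) + 7) * ((n : ℚ) + 6) * ((n : ℚ) + 5) * ((n : ℚ) + 4) / 24) + (((n : ℚ) + 7) * ((n : ℚ) + 6) * ((n : ℚ) + 5) * ((n : ℚ) + 4) * ((n : ℚ) + 3) / 120) + (((n : ℚ) + 7) * ((n : ℚ) + 6) * ((n : ℚ) + 5) * ((n : ℚ) + 4) * ((n : ℚ) + 3) * ((n : ℚ)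 + 2) / 720) + (((n : ℚ) + 7) * ((n : ℚ) + 6) * ((n : ℚ) + 5) * ((n : ℚ) + 4) * ((n : ℚ) + 3) * ((n : ℚ) + 2) * ((n : ℚ) + 1) / 5040)) - (1 + ((n : ℚ) + 7))) / (((n : ℚ) + 7) * ((n : ℚ) + 6) * ((n : ℚ) + 5) * ((n : ℚ) + 4) * ((n : ℚ) + 3) * ((n : ℚ) + 2) * ((n : ℚ) + 1) / 5040)))

/-- `cwSum` as an explicit rational function (`n ≥ 2`). -/
theorem cw_eq_P (n : ℕ) (hn : 2 ≤ n) : cwSum n = cwP n := by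
  rw [cw_closed n hn]; unfold cwP
  rw [choose_two_cast]

/-- `ct4Sum` as an explicit rational function (`n ≥ 2`). -/
theorem ct4_eq_P (n : ℕ) (hn : 2 ≤ n) : ct4Sum n = ct4P n := by
  rw [ct4_closed, texp_7_1 n hn, texp_7_0 n hn]; unfold ct4P
  simp only [choose_six_cast, choose_five_cast, choose_four_cast, choose_three_cast, choose_two_cast]
  push_cast
  simp only [pow_add]
  ring_nf

/-- `ct5Sum` as an explicit rational function (`n ≥ 2`). -/
theorem ct5_eq_P (n : ℕ) (hn : 2 ≤ n) : ct5Sum n = ct5P n := by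
  rw [ct5_closed, texp_8_1 n hn, texp_8_0 n hn]; unfold ct5P
  simp only [choose_seven_cast, choose_six_cast, choose_five_cast, choose_four_cast, choose_three_cast, choose_two_cast]
  push_cast
  simp only [pow_add]
  ring_nf

end PercRepro.NightThree.U1
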